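import Mathlib
import Summits.NavierStokesRegularity.NavierStokesRegularity.Theorems.EulerZoomLiouvillePowerGaugeEulerLiouvilleSelfSimilarLEI
import Summits.NavierStokesRegularity.NavierStokesRegularity.Theorems.EulerZoomLiouvillePowerGaugeEulerLiouvilleWindowFluxTools
import Summits.NavierStokesRegularity.NavierStokesRegularity.Theorems.EulerZoomLiouvillePowerGaugeEulerLiouvilleSelfSimilarEndpointFlux
import HarnessLib

/-!
# Rung C2 of the crux `EulerZoomLiouville.PowerGaugeEulerLiouville` at the endpoint `ρ = 1/2`:
# tools for DISCRETELY self-similar members (weak class, physical variables)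

Route №10 `EulerZoomLiouville` (NavierStokesRegularity), crux E = stmt-NavierStokesRegularity-19832,
tenure rung C2 (`Cruxes/PowerGaugeEulerLiouville/Lines/rungC_window.lean`, `Sig.rungC2_dss`:
discretely self-similar members of Seregin's power-gauged ancient Euler class vanish) at the
energy-conserving endpoint `ρ = 1/2` (Chae–Shvydkoy `α = N/2 = 3/2`).  A member `(u, p)` is
DISCRETELY SELF-SIMILAR with factor `l > 1` for the class scaling at `ρ = 1/2` when
`u(τ, y) = l^{3/2} u(l^{5/2} τ, l y)` and `p(τ, y) = l³ p(l^{5/2} τ, l y)` (`τ < 0`).  The DSS strata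
of this lineage work in PHYSICAL variables over one period `(l^{5/2} τ₀, τ₀)` (no time-periodic
profile dictionary is needed).  Tools:

* `integral_norm_sq_mul_of_dss_slice`, `integral_flux_mul_of_dss_slice` — one-slice change of
  variables: the slice `l^{5/2} τ` is the slice `τ` spread to scale `l`
  (`∫ |u(l^{5/2}τ)|² g = ∫ |u(τ)|² g(l ·)`, `∫ F(l^{5/2}τ) g = l^{−3/2} ∫ F(τ) g(l ·)`,
  `F = |u|³ + 2|p||u|`);
* `setIntegral_Ioo_comp_mul_left`, `ae_comp_mul_left` — time substitution over a period; a.e.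
  statements survive the time dilation;
* `integrableOn_pressure_velocity_of_suitable` — `|p||u| ∈ L¹` on compact subsets of the slab
  (Hölder `(3/2, 3)`), for every suitable weak pair;
* `exists_cutoffFamily` — the radial cut-offs `σ_c = σ(·/c)` (`= 1` on `B̄_{c/2}`, `= 0` off `B_c`,
  `|∇σ_c| ≤ K/c` supported in the shell, and `σ_c(l ·) = σ_{c/l}`);
* `exists_ae_slice_energy_facts` — on a compact time interval of the slab, a.e. slice `u(t)` is
  a.e.-strongly measurable, square integrable on `B̄_R` with a uniform bound (the energy class of the
  member), hence its energies against weights `0 ≤ w ≤ 1` supported in `B̄_R` are uniformly bounded;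
* `aestronglyMeasurable_sliceWeightEnergy`, `aestronglyMeasurable_sliceSetEnergy` — the slice
  energies are a.e.-strongly measurable in time (Fubini).

WHAT THIS IS NOT: not NS, not E, not rung C2 — bookkeeping for the DSS endpoint stratum
(`…DSSEndpointShell`, `…DSSEndpointDecay`, `…DSSEndpointMember`).
-/

noncomputable section

-- flat `Theorems/<Route><Decl>…` files of one crux share the namespace of the crux (tree convention)
set_option linter.dupNamespace false

open MeasureTheory Set Filter Topology Metric Function TopologicalSpace
open scoped ENNReal NNReal InnerProductSpace RealInnerProductSpace

namespace Summit.NavierStokesRegularity.NavierStokesRegularity.Theorems.PowerGaugeEulerLiouville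

open Literature.Analysis Literature.Analysis.FunctionSpaces Literature.Analysis.FluidPDE

/-! ## One-slice change of variables under the DSS relation -/

section Slice

variable {V W : EuclideanSpace ℝ (Fin 3) → EuclideanSpace ℝ (Fin 3)} {P Q : EuclideanSpace ℝ (Fin 3) → ℝ}
  {a l : ℝ}

/-- **Energy of a spread slice.**  If `V = a • W(l ·)` with `a² = l³` (`l > 0`; for a DSS member
at `ρ = 1/2`, `V = u(τ)`, `W = u(l^{5/2} τ)`, `a = l^{3/2}`), then for every weight `g`:
`∫ |W|² g = ∫ |V|² g(l ·)`. [folklore] -/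
theorem integral_norm_sq_mul_of_dss_slice (hl : 0 < l) (ha : a ^ 2 = l ^ 3)
    (hVW : ∀ y, V y = a • W (l • y)) (g : EuclideanSpace ℝ (Fin 3) → ℝ) :
    ∫ y, ‖W y‖ ^ 2 * g y = ∫ z, ‖V z‖ ^ 2 * g (l • z) := by
  have h1 : (fun z => ‖V z‖ ^ 2 * g (l • z)) = fun z => a ^ 2 * (‖W (l • z)‖ ^ 2 * g (l • z)) := by
    funext z
    rw [hVW z, norm_smul, Real.norm_eq_abs, mul_pow, sq_abs]
    ring
  have h2 := Measure.integral_comp_smul_of_nonneg (μ := volume)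
    (fun y : EuclideanSpace ℝ (Fin 3) => ‖W y‖ ^ 2 * g y) l (hR := hl.le)
  rw [finrank_euclideanSpace_fin, smul_eq_mul] at h2
  rw [h1, integral_const_mul, h2, ha, ← mul_assoc, mul_inv_cancel₀ (by positivity), one_mul]

/-- **Cubic + pressure flux density of a spread slice.**  If `V = a • W(l ·)`, `P = l³ Q(l ·)`
with `a = l^{3/2}` (`l > 0`), then for every weight `g`:
`∫ (|W|³ + 2|Q||W|) g = l^{−3/2} ∫ (|V|³ + 2|P||V|) g(l ·)`. [folklore] -/
theorem integral_flux_mul_of_dss_slice (hl : 0 < l) (ha : a = l ^ (3 / 2 : ℝ))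
    (hVW : ∀ y, V y = a • W (l • y)) (hPQ : ∀ y, P y = l ^ 3 * Q (l • y))
    (g : EuclideanSpace ℝ (Fin 3) → ℝ) :
    ∫ y, (‖W y‖ ^ 3 + 2 * (|Q y| * ‖W y‖)) * g y =
      l ^ (-(3 / 2 : ℝ)) * ∫ z, (‖V z‖ ^ 3 + 2 * (|P z| * ‖V z‖)) * g (l • z) := by
  have ha0 : 0 < a := by rw [ha]; exact Real.rpow_pos_of_pos hl _
  have ha3 : a ^ 3 = l ^ (9 / 2 : ℝ) := by
    rw [ha, ← Real.rpow_natCast, ← Real.rpow_mul hl.le]; norm_num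
  have hla : l ^ 3 * a = l ^ (9 / 2 : ℝ) := by
    rw [ha, ← Real.rpow_natCast l 3, ← Real.rpow_add hl]; norm_num
  have h1 : (fun z => (‖V z‖ ^ 3 + 2 * (|P z| * ‖V z‖)) * g (l • z)) =
      fun z => l ^ (9 / 2 : ℝ) * ((‖W (l • z)‖ ^ 3 + 2 * (|Q (l • z)| * ‖W (l • z)‖)) * g (l • z)) := by
    funext z
    rw [hVW z, hPQ z, norm_smul, Real.norm_eq_abs, abs_of_pos ha0, abs_mul,
      abs_of_pos (pow_pos hl 3)]
    have : (a * ‖W (l • z)‖) ^ 3 + 2 * (l ^ 3 * |Q (l • z)| * (a * ‖W (l • z)‖)) =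
        a ^ 3 * ‖W (l • z)‖ ^ 3 + (l ^ 3 * a) * (2 * (|Q (l • z)| * ‖W (l • z)‖)) := by ring
    rw [this, ha3, hla]
    ring
  have h2 := Measure.integral_comp_smul_of_nonneg (μ := volume)
    (fun y : EuclideanSpace ℝ (Fin 3) => (‖W y‖ ^ 3 + 2 * (|Q y| * ‖W y‖)) * g y) l (hR := hl.le)
  rw [finrank_euclideanSpace_fin, smul_eq_mul] at h2
  rw [h1, integral_const_mul, h2, ← mul_assoc, ← mul_assoc]
  have h3 : l ^ (-(3 / 2 : ℝ)) * l ^ (9 / 2 : ℝ) * (l ^ 3)⁻¹ = 1 := by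
    rw [← Real.rpow_add hl, ← Real.rpow_natCast l 3, ← Real.rpow_neg hl.le, ← Real.rpow_add hl]
    norm_num
  rw [h3, one_mul]

/-- **Time substitution over a period**: `∫_{(b a', b b')} g = b ∫_{(a', b')} g(b ·)` for `b > 0`.
[folklore] -/
theorem setIntegral_Ioo_comp_mul_left {b a' b' : ℝ} (hb : 0 < b) (g : ℝ → ℝ) :
    ∫ τ in Ioo (b * a') (b * b'), g τ = b * ∫ τ in Ioo a' b', g (b * τ) := by
  have h := Measure.setIntegral_comp_smul_of_pos (μ := volume) g (Ioo a' b') hb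
  simp only [smul_eq_mul, Module.finrank_self, pow_one] at h
  rw [LinearOrderedField.smul_Ioo hb] at h
  rw [h, ← mul_assoc, mul_inv_cancel₀ hb.ne', one_mul]

end Slice

/-! ## `|p||u|` is integrable on compact subsets of the slab -/

section PressureVelocity

/-- **`|p||u| ∈ L¹_loc` on the slab.**  For a suitable weak (Euler or Navier–Stokes) pair on the
slab `(−∞,0) × ℝ³`, `|p||u|` is integrable on every compact subset: Hölder `(3/2, 3)` with
`p ∈ L^{3/2}_loc` (Lin's class) and `|u|³ ∈ L¹_loc` (`locallyIntegrableOn_cube_of_suitable`).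
[folklore] -/
theorem integrableOn_pressure_velocity_of_suitable {ν : ℝ}
    {u : ℝ → EuclideanSpace ℝ (Fin 3) → EuclideanSpace ℝ (Fin 3)}
    {p : ℝ → EuclideanSpace ℝ (Fin 3) → ℝ}
    (hsw : IsSuitableWeakSolutionOn (slab (EuclideanSpace ℝ (Fin 3)) (Iio 0) isOpen_Iio) ν 0 u p)
    {K : Set (ℝ × EuclideanSpace ℝ (Fin 3))} (hK : IsCompact K)
    (hKS : K ⊆ ((slab (EuclideanSpace ℝ (Fin 3)) (Iio 0) isOpen_Iio :
      Opens (ℝ × EuclideanSpace ℝ (Fin 3))) : Set (ℝ × EuclideanSpace ℝ (Fin 3)))) :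
    IntegrableOn (fun z : ℝ × EuclideanSpace ℝ (Fin 3) => |p z.1 z.2| * ‖u z.1 z.2‖) K volume := by
  have hum : AEStronglyMeasurable (uncurry u) (volume.restrict K) := by
    obtain ⟨G, hG, -, -⟩ := hsw.localEnergy
    exact (hG.locallyIntegrableOn.mono_set hKS).aestronglyMeasurable
  have hpm : AEStronglyMeasurable (uncurry p) (volume.restrict K) :=
    (hsw.distributional.2.2.1.mono_set hKS).aestronglyMeasurable
  have hu3 : ∫⁻ z in K, ‖u z.1 z.2‖ₑ ^ (3 : ℝ) < ⊤ := by
    have h := ((locallyIntegrableOn_cube_of_suitable hsw).integrableOn_compact_subset hKS hK).2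
    rw [HasFiniteIntegral] at h
    refine lt_of_le_of_lt (le_of_eq (lintegral_congr_ae (Eventually.of_forall fun z => ?_))) h
    show ‖u z.1 z.2‖ₑ ^ (3 : ℝ) = ‖‖u z.1 z.2‖ ^ 3‖ₑ
    rw [Real.enorm_eq_ofReal (by positivity), ENNReal.ofReal_pow (norm_nonneg _),
      ofReal_norm]
    norm_cast
  have hp32 := hsw.pressure K hKS hK
  refine ⟨(continuous_abs.comp_aestronglyMeasurable hpm).mul hum.norm, ?_⟩
  rw [HasFiniteIntegral]
  have hH := WindowFlux.lintegral_mul_le_threeHalves_three (volume.restrict K)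
    (f := fun z : ℝ × EuclideanSpace ℝ (Fin 3) => ‖p z.1 z.2‖ₑ)
    (g := fun z : ℝ × EuclideanSpace ℝ (Fin 3) => ‖u z.1 z.2‖ₑ)
    hpm.enorm hum.enorm
  refine lt_of_le_of_lt (le_trans (le_of_eq (lintegral_congr_ae (Eventually.of_forall fun z => ?_))) hH) ?_
  · show ‖|p z.1 z.2| * ‖u z.1 z.2‖‖ₑ = ‖p z.1 z.2‖ₑ * ‖u z.1 z.2‖ₑ
    rw [enorm_mul, Real.enorm_abs, enorm_norm]
  · exact ENNReal.mul_lt_top (ENNReal.rpow_lt_top_of_nonneg (by norm_num) hp32.ne)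
      (ENNReal.rpow_lt_top_of_nonneg (by norm_num) hu3.ne)

end PressureVelocity

/-! ## Time dilation -/

section Time


/-- A property holding for a.e. `x : ℝ` holds for a.e. `x` at `b x` (`b ≠ 0`): the dilation
`x ↦ b x` is quasi-measure-preserving for Lebesgue measure. [folklore] -/
theorem ae_comp_mul_left {P : ℝ → Prop} (h : ∀ᵐ x : ℝ, P x) {b : ℝ} (hb : b ≠ 0) :
    ∀ᵐ x : ℝ, P (b * x) := by
  have hq : Measure.QuasiMeasurePreserving (fun x : ℝ => b * x) volume volume := by
    refine ⟨measurable_const_mul b, ?_⟩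
    rw [Real.map_volume_mul_left hb]
    exact Measure.smul_absolutelyContinuous
  exact hq.tendsto_ae.eventually h

end Time

/-! ## A one-parameter family of radial cut-offs -/

section Cutoff

/-- **The scaled radial cut-offs.**  There are `σ_c : ℝ³ → [0,1]` (`c > 0`), smooth with compact
support, `σ_c = 1` on `B̄_{c/2}`, `σ_c = 0` off `B_c`, `|∇σ_c| ≤ K/c` with `∇σ_c` supported in
`c/2 ≤ |y| ≤ c`, and DILATION-COVARIANT: `σ_c(l y) = σ_{c/l}(y)` (`σ_c = σ(·/c)` for the tree's
radial bump `σ`). [folklore] -/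
theorem exists_cutoffFamily :
    ∃ (S : ℝ → EuclideanSpace ℝ (Fin 3) → ℝ) (K : ℝ), 0 ≤ K ∧
      (∀ (c l : ℝ) (z : EuclideanSpace ℝ (Fin 3)), l ≠ 0 → S c (l • z) = S (c / l) z) ∧
      ∀ c : ℝ, 0 < c →
        ContDiff ℝ (⊤ : ℕ∞) (S c) ∧ HasCompactSupport (S c) ∧ Continuous (S c) ∧
        (∀ y, 0 ≤ S c y) ∧ (∀ y, S c y ≤ 1) ∧ (∀ y, ‖y‖ ≤ c / 2 → S c y = 1) ∧
        (∀ y, c ≤ ‖y‖ → S c y = 0) ∧ (∀ y, ‖gradient (S c) y‖ ≤ K / c) ∧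
        (∀ y, gradient (S c) y ≠ 0 → c / 2 ≤ ‖y‖ ∧ ‖y‖ ≤ c) := by
  obtain ⟨σ, hσ, hσc, hσ0, hσ1, hσone, hσzero, hσgrad⟩ := exists_radialBump
  obtain ⟨K, hK0, hK⟩ := exists_norm_gradient_le hσ hσc
  refine ⟨fun c y => σ (c⁻¹ • y), K, hK0, fun c l z hl => ?_, fun c hc => ?_⟩
  · show σ (c⁻¹ • l • z) = σ ((c / l)⁻¹ • z)
    rw [smul_smul, inv_div, div_eq_inv_mul]
  have hnorm : ∀ y : EuclideanSpace ℝ (Fin 3), ‖c⁻¹ • y‖ = ‖y‖ / c := fun y => by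
    rw [norm_smul, norm_inv, Real.norm_eq_abs, abs_of_pos hc, div_eq_inv_mul]
  have hgrad : ∀ y, gradient (fun y => σ (c⁻¹ • y)) y = c⁻¹ • gradient σ (c⁻¹ • y) := fun y => by
    simp only [gradient, _root_.fderiv_comp_smul, map_smul]
  refine ⟨hσ.comp (contDiff_const_smul _), hσc.comp_smul (inv_ne_zero hc.ne'),
    hσ.continuous.comp (continuous_const_smul _), fun y => hσ0 _, fun y => hσ1 _,
    fun y hy => hσone _ ?_, fun y hy => hσzero _ ?_, fun y => ?_, fun y hy => ?_⟩
  · rw [hnorm, div_le_iff₀ hc]; linarith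
  · rw [hnorm, le_div_iff₀ hc]; linarith
  · show ‖gradient (fun y => σ (c⁻¹ • y)) y‖ ≤ K / c
    rw [hgrad, norm_smul, norm_inv, Real.norm_eq_abs, abs_of_pos hc, div_eq_inv_mul]
    exact mul_le_mul_of_nonneg_left (hK _) (by positivity)
  · have hy' : gradient (fun y => σ (c⁻¹ • y)) y ≠ 0 := hy
    rw [hgrad] at hy'
    have h' : gradient σ (c⁻¹ • y) ≠ 0 := fun h0 => hy' (by rw [h0, smul_zero])
    have h2 := hσgrad _ h'
    rw [hnorm, le_div_iff₀ hc, div_le_iff₀ hc] at h2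
    constructor <;> linarith [h2.1, h2.2]

end Cutoff

/-! ## Slice energies on a compact time interval -/

section SliceEnergy

variable {u : ℝ → EuclideanSpace ℝ (Fin 3) → EuclideanSpace ℝ (Fin 3)}
  {p : ℝ → EuclideanSpace ℝ (Fin 3) → ℝ}

/-- **Slice energies on a compact time interval (energy class of the member).**  For a suitable
weak pair on the slab `(−∞,0) × ℝ³`, a time interval `(α, β)` with `β < 0` and a radius `R`, there
is `C` such that for a.e. `t ∈ (α, β)`: the slice `u(t)` is a.e.-strongly measurable, `|u(t)|²` is
integrable on `B̄_R` with `∫_{B̄_R} |u(t)|² ≤ C`, and for every continuous weight `0 ≤ w ≤ 1`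
vanishing on `{|y| ≥ R}` the energy `∫ |u(t)|² w` exists and lies in `[0, C]`
(CKN (2.1): `u ∈ L^∞_t L²_x` on compact subsets). [cite: CaffarelliKohnNirenberg1982, §2 (2.1)] -/
theorem exists_ae_slice_energy_facts {ν : ℝ}
    (hsw : IsSuitableWeakSolutionOn (slab (EuclideanSpace ℝ (Fin 3)) (Iio 0) isOpen_Iio) ν 0 u p)
    {α β : ℝ} (hβ : β < 0) (R : ℝ) :
    ∃ C : ℝ≥0, ∀ᵐ t : ℝ, t ∈ Ioo α β →
      AEStronglyMeasurable (u t) volume ∧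
      IntegrableOn (fun y => ‖u t y‖ ^ 2) (closedBall (0 : EuclideanSpace ℝ (Fin 3)) R) volume ∧
      (∫ y in closedBall (0 : EuclideanSpace ℝ (Fin 3)) R, ‖u t y‖ ^ 2) ≤ C ∧
      ∀ w : EuclideanSpace ℝ (Fin 3) → ℝ, Continuous w → (∀ y, 0 ≤ w y) → (∀ y, w y ≤ 1) →
        (∀ y, R ≤ ‖y‖ → w y = 0) →
        Integrable (fun y => ‖u t y‖ ^ 2 * w y) volume ∧
          0 ≤ ∫ y, ‖u t y‖ ^ 2 * w y ∧ ∫ y, ‖u t y‖ ^ 2 * w y ≤ C := by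
  -- measurability of `u` on the slab and of a.e. slice
  have hum : AEStronglyMeasurable (uncurry u)
      (volume.restrict (Iio (0 : ℝ) ×ˢ (univ : Set (EuclideanSpace ℝ (Fin 3))))) := by
    obtain ⟨G, hG, -, -⟩ := hsw.localEnergy
    have := hG.locallyIntegrableOn.aestronglyMeasurable
    simpa [slab] using this
  have hprodIio : (volume.restrict (Iio (0 : ℝ))).prod (volume : Measure (EuclideanSpace ℝ (Fin 3))) =
      volume.restrict (Iio (0 : ℝ) ×ˢ (univ : Set (EuclideanSpace ℝ (Fin 3)))) := by
    rw [Measure.restrict_prod_eq_prod_univ, ← Measure.volume_eq_prod]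
  have hslice : ∀ᵐ t : ℝ, t < 0 → AEStronglyMeasurable (u t) volume := by
    have h : ∀ᵐ t ∂(volume.restrict (Iio (0 : ℝ))),
        AEStronglyMeasurable (fun y => uncurry u (t, y)) volume := by
      have hum' : AEStronglyMeasurable (uncurry u)
          ((volume.restrict (Iio (0 : ℝ))).prod (volume : Measure (EuclideanSpace ℝ (Fin 3)))) := by
        rw [hprodIio]; exact hum
      exact hum'.prodMk_left
    exact (ae_restrict_iff' measurableSet_Iio).1 h
  -- the energy class on the compact box `[α, β] × B̄_R`
  set K' : Set (ℝ × EuclideanSpace ℝ (Fin 3)) :=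
    Icc α β ×ˢ closedBall (0 : EuclideanSpace ℝ (Fin 3)) R with hK'
  have hK'c : IsCompact K' := isCompact_Icc.prod (isCompact_closedBall _ _)
  have hK'S : K' ⊆ ((slab (EuclideanSpace ℝ (Fin 3)) (Iio 0) isOpen_Iio :
      Opens (ℝ × EuclideanSpace ℝ (Fin 3))) : Set (ℝ × EuclideanSpace ℝ (Fin 3))) := by
    rintro ⟨t, x⟩ ⟨ht, -⟩
    rw [SetLike.mem_coe, mem_slab]
    exact lt_of_le_of_lt ht.2 hβ
  obtain ⟨C, hC⟩ := hsw.energyClass K' hK'S hK'c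
  refine ⟨C, ?_⟩
  filter_upwards [hC, hslice] with t ht hst htJ
  have ht0 : t < 0 := htJ.2.trans hβ
  have hm := hst ht0
  have hind : (fun x => K'.indicator (fun z : ℝ × EuclideanSpace ℝ (Fin 3) => ‖u z.1 z.2‖ₑ ^ 2) (t, x)) =
      (closedBall (0 : EuclideanSpace ℝ (Fin 3)) R).indicator (fun x => ‖u t x‖ₑ ^ 2) := by
    funext x
    by_cases hx : x ∈ closedBall (0 : EuclideanSpace ℝ (Fin 3)) R
    · rw [indicator_of_mem hx, indicator_of_mem (show (t, x) ∈ K' from ⟨Ioo_subset_Icc_self htJ, hx⟩)]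
    · rw [indicator_of_notMem hx, indicator_of_notMem (fun h => hx h.2)]
  rw [hind, lintegral_indicator measurableSet_closedBall] at ht
  have hI : IntegrableOn (fun y => ‖u t y‖ ^ 2) (closedBall (0 : EuclideanSpace ℝ (Fin 3)) R)
      volume := by
    refine ⟨(hm.norm.pow 2).restrict, ?_⟩
    rw [HasFiniteIntegral]
    refine lt_of_le_of_lt (le_of_eq ?_) (lt_of_le_of_lt ht ENNReal.coe_lt_top)
    refine lintegral_congr_ae (Eventually.of_forall fun y => ?_)
    show ‖‖u t y‖ ^ 2‖ₑ = ‖u t y‖ₑ ^ 2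
    rw [Real.enorm_eq_ofReal (by positivity), ENNReal.ofReal_pow (norm_nonneg _), ofReal_norm]
  have hIC : (∫ y in closedBall (0 : EuclideanSpace ℝ (Fin 3)) R, ‖u t y‖ ^ 2) ≤ C := by
    rw [integral_eq_lintegral_of_nonneg_ae (f := fun y => ‖u t y‖ ^ 2)
      (Eventually.of_forall fun y => (by positivity : (0 : ℝ) ≤ ‖u t y‖ ^ 2))
      (by exact (hm.norm.pow 2).restrict)]
    have h2 : ∫⁻ y in closedBall (0 : EuclideanSpace ℝ (Fin 3)) R, ENNReal.ofReal (‖u t y‖ ^ 2) =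
        ∫⁻ y in closedBall (0 : EuclideanSpace ℝ (Fin 3)) R, ‖u t y‖ₑ ^ 2 :=
      lintegral_congr_ae (Eventually.of_forall fun y => by
        show ENNReal.ofReal (‖u t y‖ ^ 2) = ‖u t y‖ₑ ^ 2
        rw [ENNReal.ofReal_pow (norm_nonneg _), ofReal_norm])
    rw [h2]
    have := ENNReal.toReal_mono ENNReal.coe_ne_top ht
    rwa [ENNReal.coe_toReal] at this
  refine ⟨hm, hI, hIC, fun w hwc hw0 hw1 hwz => ?_⟩
  have hind' : (fun y => ‖u t y‖ ^ 2 * w y) =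
      (closedBall (0 : EuclideanSpace ℝ (Fin 3)) R).indicator (fun y => ‖u t y‖ ^ 2 * w y) := by
    funext y
    by_cases hy : y ∈ closedBall (0 : EuclideanSpace ℝ (Fin 3)) R
    · rw [indicator_of_mem hy]
    · rw [mem_closedBall, dist_zero_right, not_le] at hy
      rw [indicator_of_notMem (by rwa [mem_closedBall, dist_zero_right, not_le]), hwz y hy.le,
        mul_zero]
  have hI' : IntegrableOn (fun y => ‖u t y‖ ^ 2 * w y)
      (closedBall (0 : EuclideanSpace ℝ (Fin 3)) R) volume :=
    hI.mono' ((hm.norm.pow 2).restrict.mul hwc.aestronglyMeasurable)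
      (Eventually.of_forall fun y => by
        rw [Real.norm_eq_abs, abs_of_nonneg (mul_nonneg (by positivity) (hw0 y))]
        exact mul_le_of_le_one_right (by positivity) (hw1 y))
  refine ⟨?_, integral_nonneg fun y => mul_nonneg (by positivity) (hw0 y), ?_⟩
  · rw [hind']; exact hI'.integrable_indicator measurableSet_closedBall
  · rw [hind', integral_indicator measurableSet_closedBall]
    exact (setIntegral_mono hI' hI fun y => mul_le_of_le_one_right (by positivity) (hw1 y)).trans hIC

/-- **Measurability in time of weighted slice energies** `τ ↦ ∫ |u(τ)|² w` on a time set
`J ⊆ (−∞,0)`, for `u` a.e.-strongly measurable on the slab and `w` continuous (Fubini).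
[folklore] -/
theorem aestronglyMeasurable_sliceWeightEnergy
    (hum : AEStronglyMeasurable (uncurry u)
      (volume.restrict (Iio (0 : ℝ) ×ˢ (univ : Set (EuclideanSpace ℝ (Fin 3))))))
    {J : Set ℝ} (hJ : J ⊆ Iio 0) {w : EuclideanSpace ℝ (Fin 3) → ℝ} (hwc : Continuous w) :
    AEStronglyMeasurable (fun τ => ∫ y, ‖u τ y‖ ^ 2 * w y) (volume.restrict J) := by
  have hprodJ : (volume.restrict J).prod (volume : Measure (EuclideanSpace ℝ (Fin 3))) =
      volume.restrict (J ×ˢ (univ : Set (EuclideanSpace ℝ (Fin 3)))) := by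
    rw [Measure.restrict_prod_eq_prod_univ, ← Measure.volume_eq_prod]
  have humJ : AEStronglyMeasurable (uncurry u)
      ((volume.restrict J).prod (volume : Measure (EuclideanSpace ℝ (Fin 3)))) := by
    rw [hprodJ]
    exact hum.mono_measure (Measure.restrict_mono (prod_mono hJ subset_rfl) le_rfl)
  have h : AEStronglyMeasurable (fun z : ℝ × EuclideanSpace ℝ (Fin 3) => ‖uncurry u z‖ ^ 2 * w z.2)
      ((volume.restrict J).prod volume) :=
    (humJ.norm.pow 2).mul (hwc.comp continuous_snd).aestronglyMeasurable
  exact h.integral_prod_right'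

/-- **Measurability in time of slice energies on a measurable set** `τ ↦ ∫_A |u(τ)|²` on a time set
`J ⊆ (−∞,0)` (Fubini). [folklore] -/
theorem aestronglyMeasurable_sliceSetEnergy
    (hum : AEStronglyMeasurable (uncurry u)
      (volume.restrict (Iio (0 : ℝ) ×ˢ (univ : Set (EuclideanSpace ℝ (Fin 3))))))
    {J : Set ℝ} (hJ : J ⊆ Iio 0) {A : Set (EuclideanSpace ℝ (Fin 3))} (hA : MeasurableSet A) :
    AEStronglyMeasurable (fun τ => ∫ y in A, ‖u τ y‖ ^ 2) (volume.restrict J) := by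
  have hprodJ : (volume.restrict J).prod (volume : Measure (EuclideanSpace ℝ (Fin 3))) =
      volume.restrict (J ×ˢ (univ : Set (EuclideanSpace ℝ (Fin 3)))) := by
    rw [Measure.restrict_prod_eq_prod_univ, ← Measure.volume_eq_prod]
  have humJ : AEStronglyMeasurable (uncurry u)
      ((volume.restrict J).prod (volume : Measure (EuclideanSpace ℝ (Fin 3)))) := by
    rw [hprodJ]
    exact hum.mono_measure (Measure.restrict_mono (prod_mono hJ subset_rfl) le_rfl)
  have h : AEStronglyMeasurable (fun z : ℝ × EuclideanSpace ℝ (Fin 3) =>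
      ((univ : Set ℝ) ×ˢ A).indicator (fun z => ‖uncurry u z‖ ^ 2) z) ((volume.restrict J).prod volume) :=
    (humJ.norm.pow 2).indicator (MeasurableSet.univ.prod hA)
  refine h.integral_prod_right'.congr (Eventually.of_forall fun τ => ?_)
  show (∫ y, ((univ : Set ℝ) ×ˢ A).indicator (fun z => ‖uncurry u z‖ ^ 2) (τ, y)) =
    ∫ y in A, ‖u τ y‖ ^ 2
  rw [← integral_indicator hA]
  congr 1; funext y
  by_cases hy : y ∈ A
  · rw [indicator_of_mem hy, indicator_of_mem (show (τ, y) ∈ (univ : Set ℝ) ×ˢ A from ⟨mem_univ _, hy⟩)]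
    rfl
  · rw [indicator_of_notMem hy, indicator_of_notMem (fun h => hy h.2)]

end SliceEnergy

end Summit.NavierStokesRegularity.NavierStokesRegularity.Theorems.PowerGaugeEulerLiouville
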